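import Summits.NavierStokesRegularity.NavierStokesRegularity.Theorems.ExtremiserTransienceNearExtremalTransienceExtremiserLiouvillePlateau
import Summits.NavierStokesRegularity.NavierStokesRegularity.Theorems.ExtremiserTransiencePlateauSliceRigidity
import Summits.NavierStokesRegularity.NavierStokesRegularity.Theorems.ExtremiserTransienceKStarAttainedHalfSpaceVariation
import Summits.NavierStokesRegularity.NavierStokesRegularity.Theorems.ExtremiserTransiencePerFlowScaleLock
import Literature.Analysis.FluidPDE.TypeIAncientMild
import Summits.NavierStokesRegularity.NavierStokesRegularity.Theorems.LiouvilleConjectureNS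
import HarnessLib

/-!
# Route `ExtremiserTransience`, LINE g7-δ «coherent member selection» (seat ns-idea-5 g7): the PROVED part of the line —
# vocabulary, the efficient-times theorem, the extremal-branch kill, the placement of the tube stub below (L), and the reduction

`--supports stmt-NavierStokesRegularity-26567` (`NearExtremalTransiencePerFlow`, the deciding crux of the route; rev 21).  This file is
the sorry-free part of the registered/published skeleton `Cruxes/NearExtremalTransiencePerFlow/Lines/member_selection.lean` (v4,
critic verdict PASS 2026-08-28T19:12:24Z), moved to `Theorems/` so that the board shows the line's residual BY NAME (critic note N2):
after this file the OPEN content of LINE g7-δ is exactly {`CoherentSelection` (T1, slice-level analysis — the new lever),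
`ZoomPackage` (T2, zoom glue), `NoTubeSlice` (T3, the one open heart, below the Liouville conjecture (L))}.

Content (kernel-checked):
* §0 vocabulary: `PFC` (the per-flow conclusion of 26567 verbatim), `IsViolator`, `EfficientTimesData`, `NearExtremalFamily`,
  `IsExtremalSlice` (slice clause of items 26569/27696 verbatim), `IsTubeSlice`, `ZoomCompact`; §1 the four statements T0–T3;
* `share_le_of_taylor` — the share bound of the selection lever (pure algebra): cores of Taylor scale `≥ L₁` carry total
  Cauchy–Schwarz weight `≤ (√Θ/L₁)·√(ZP)` under the Taylor bound `Z ≤ ΘP`;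
* `efficientTimesNoDust_holds : EfficientTimesNoDust` (T0) — a violator flow has late times `t n → T`, strictly `κ⋆(1-1/(n+2))`-efficient
  at a height bound `Mb n > 0`, with non-trivial budgets AND the Taylor bound `Z ≤ Θ·ν(T-t n)·P` — from the landed sequential upper scale
  lock `PerFlow.upperLock_at_nearEfficient_times` and the flow-wise sharp inequality `flowwise_of_universal sharpDepletion_is_universal`;
* `not_isExtremalSlice_of_typeIAncientMild` — NO slice of a Type-I ancient mild field is an exactly extremal extended slice: equality in
  the landed `ExtremiserLiouville.extendedSharp` gives a plateau of positive volume (`ext_interior_contact_nonempty_of_extremal`), which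
  the landed `plateauSliceRigidity` (item 27823) excludes (the one-slice form of ns-idea-10's K1 bypass);
* `noTubeSlice_of_liouvilleConjectureNS : LiouvilleConjectureNS → NoTubeSlice` — T3 sits below the canonical conjecture (L);
* `nearExtremalTransiencePerFlow_of_selection : CoherentSelection → ZoomPackage → NoTubeSlice → NearExtremalTransiencePerFlow` — the
  rung 26567 by name from the three open pieces.
HONEST FRAMING: T0 and the reduction are statements about hypothetical Type-I singular flows (vacuous if none exist); T1, T2, T3 are
OPEN and nothing here proves them; nothing about Navier–Stokes regularity or blow-up is proved, and no summit is proved by a line. [folklore]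
-/


noncomputable section

open scoped Topology InnerProductSpace RealInnerProductSpace ENNReal ContDiff
open MeasureTheory Filter Set Metric
open Literature.Analysis.FluidPDE
open Summit.NavierStokesRegularity.NavierStokesRegularity.Theses.ExtremiserTransience
open Summit.NavierStokesRegularity.NavierStokesRegularity.Theorems
open Summit.NavierStokesRegularity.NavierStokesRegularity.Theorems.ExtremiserLiouville
open Summit.NavierStokesRegularity.NavierStokesRegularity.Theorems.DepletionLadder.KStar.HalfSpace

namespace Summit.NavierStokesRegularity.NavierStokesRegularity.Theorems.DepletionLadder.PerFlow.MemberSelection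

set_option linter.dupNamespace false
set_option linter.unusedVariables false
set_option linter.style.longLine false

/-! ## §0 Vocabulary -/

/-- The per-flow CONCLUSION of the crux for the flow `u` on `[0,T)` (verbatim). -/
def PFC (T : ℝ) (u : ℝ → EuclideanSpace ℝ (Fin 3) → EuclideanSpace ℝ (Fin 3)) : Prop :=
  ∃ θ : ℝ, 0 ≤ θ ∧ θ < 1 ∧ ∀ κ : ℝ, (∀ (v : EuclideanSpace ℝ (Fin 3) → EuclideanSpace ℝ (Fin 3)) (M B : ℝ), ContDiff ℝ (⊤ : ℕ∞) v → Literature.Analysis.FluidPDE.VectorCalculus.IsDivFree v → (∀ x, ‖v x‖ ≤ M) → (∀ x, ‖fderiv ℝ v x‖ ≤ B) → (∫⁻ x, ‖iteratedFDeriv ℝ 0 v x‖ₑ ^ 2 < ⊤) → (∫⁻ x, ‖iteratedFDeriv ℝ 1 v x‖ₑ ^ 2 < ⊤) → (∫⁻ x, ‖iteratedFDeriv ℝ 2 v x‖ₑ ^ 2 < ⊤) → |∫ x, ⟪Literature.Analysis.FluidPDE.curl v x, fderiv ℝ v x (Literature.Analysis.FluidPDE.curl v x)⟫_ℝ| ≤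 κ * M * Real.sqrt (∫ x, ‖Literature.Analysis.FluidPDE.curl v x‖ ^ 2) * Real.sqrt (∫ x, Literature.Analysis.FluidPDE.frobeniusNormSq (fderiv ℝ (Literature.Analysis.FluidPDE.curl v) x))) → ∃ t₁ ∈ Set.Ico 0 T, ∃ (k : ℝ → ℝ) (B : ℝ), Measurable k ∧ (∀ τ, 0 ≤ k τ ∧ k τ ≤ 1) ∧ (∀ t ∈ Set.Ico t₁ T, ∀ M : ℝ, (∀ x, ‖u t x‖ ≤ M) → |∫ x, ⟪Literature.Analysis.FluidPDE.curl (u t) x, fderiv ℝ (u t) x (Literature.Analysis.FluidPDE.curl (u t) x)⟫_ℝ| ≤ k t * M * Real.sqrt (∫ x, ‖Literature.Analysis.FluidPDE.curl (u t) x‖ ^ 2) * Real.sqrt (∫ x, Literature.Analysis.FluidPDE.frobeniusNormSq (fderiv ℝ (Literature.Analysis.FluidPDE.curl (u t)) x))) ∧ (∀ t ∈ Set.Ico t₁ T, ∫ τ in t₁..t, k τ ^ 2 / (T - τ) ≤ (θ * κ) ^ 2 * Real.log ((T - t₁) / (T - t)) + B)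

/-- The VIOLATOR FRAME (contrapositive of the crux): a flow satisfying every hypothesis of `NearExtremalTransiencePerFlow`
whose per-flow conclusion fails. -/
def IsViolator (C ν T : ℝ) (u : ℝ → EuclideanSpace ℝ (Fin 3) → EuclideanSpace ℝ (Fin 3))
    (p : ℝ → EuclideanSpace ℝ (Fin 3) → ℝ) : Prop :=
  0 < C ∧ 0 < ν ∧ 0 < T ∧ IsClassicalNSSolutionOn (Set.Ico 0 T) ν 0 u p ∧ IsLerayHopfOn T ν 0 (u 0) u ∧
    HasRapidSpatialDecay (u 0) ∧ (∀ᶠ t in 𝓝[<] T, ∀ x, Real.sqrt (T - t) * ‖u t x‖ ≤ C * Real.sqrt ν) ∧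
    ¬ HasSmoothExtensionPast ν 0 u T ∧ ¬ PFC T u

/-- EFFICIENT-TIMES DATA WITH A TAYLOR BOUND for the flow `u` (viscosity `ν`, singular time `T`): late times `t n → T`,
height bounds `Mb n ≥ ‖u (t n)‖_∞`, efficiency deficits `ε n → 0` (`(κ⋆ - ε n)·Mb n·√Z·√P ≤ |J(u (t n))|`, which pins `Mb n`
to the true height up to the factor `κ⋆/(κ⋆-ε n)`), non-trivial budgets, and the TAYLOR BOUND `Z(t n) ≤ Θ·ν(T - t n)·P(t n)`
(dissipation length `λ² = Z/P` at most parabolic — «no dust»). -/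
def EfficientTimesData (ν T : ℝ) (u : ℝ → EuclideanSpace ℝ (Fin 3) → EuclideanSpace ℝ (Fin 3))
    (Θ : ℝ) (t Mb ε : ℕ → ℝ) : Prop :=
  (∀ n, t n ∈ Set.Ico 0 T) ∧ Tendsto t atTop (𝓝 T) ∧ Tendsto ε atTop (𝓝 0) ∧ (∀ n, 0 < Mb n) ∧
    (∀ n x, ‖u (t n) x‖ ≤ Mb n) ∧
    (∀ n, 0 < Real.sqrt (∫ x, ‖curl (u (t n)) x‖ ^ 2) * Real.sqrt (∫ x, frobeniusNormSq (fderiv ℝ (curl (u (t n))) x))) ∧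
    (∀ n, (kStar - ε n) * Mb n * Real.sqrt (∫ x, ‖curl (u (t n)) x‖ ^ 2) *
        Real.sqrt (∫ x, frobeniusNormSq (fderiv ℝ (curl (u (t n))) x)) ≤
      |∫ x, ⟪curl (u (t n)) x, fderiv ℝ (u (t n)) x (curl (u (t n)) x)⟫_ℝ|) ∧
    (∀ n, (∫ x, ‖curl (u (t n)) x‖ ^ 2) ≤ Θ * (ν * (T - t n)) * ∫ x, frobeniusNormSq (fderiv ℝ (curl (u (t n))) x))

/-- A NEAR-EXTREMAL FAMILY of height-`1` slices: smooth, divergence-free, `‖v n‖ ≤ 1`, ALL derivatives bounded uniformly in `n`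
(`Λ k` for order `k`), finite `Ḣ¹, Ḣ²` budgets, non-trivial, efficiency deficit `ε n → 0` at height `1`, and the Taylor bound
`Z ≤ Θ P`.  (Exactly what the NS-compatible blow-up zoom of a Type-I violator delivers at the times of `EfficientTimesData`, T2.) -/
def NearExtremalFamily (v : ℕ → EuclideanSpace ℝ (Fin 3) → EuclideanSpace ℝ (Fin 3)) (Λ : ℕ → ℝ) (Θ : ℝ) (ε : ℕ → ℝ) : Prop :=
  (∀ n, ContDiff ℝ (⊤ : ℕ∞) (v n)) ∧ (∀ n, Literature.Analysis.FluidPDE.VectorCalculus.IsDivFree (v n)) ∧ (∀ n x, ‖v n x‖ ≤ 1) ∧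
    (∀ (k : ℕ) n x, ‖iteratedFDeriv ℝ k (v n) x‖ ≤ Λ k) ∧
    (∀ n, (∫⁻ x, ‖iteratedFDeriv ℝ 1 (v n) x‖ₑ ^ 2 < ⊤) ∧ (∫⁻ x, ‖iteratedFDeriv ℝ 2 (v n) x‖ₑ ^ 2 < ⊤)) ∧
    Tendsto ε atTop (𝓝 0) ∧
    (∀ n, 0 < Real.sqrt (∫ x, ‖curl (v n) x‖ ^ 2) * Real.sqrt (∫ x, frobeniusNormSq (fderiv ℝ (curl (v n)) x))) ∧
    (∀ n, (kStar - ε n) * Real.sqrt (∫ x, ‖curl (v n) x‖ ^ 2) * Real.sqrt (∫ x, frobeniusNormSq (fderiv ℝ (curl (v n)) x)) ≤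
      |∫ x, ⟪curl (v n) x, fderiv ℝ (v n) x (curl (v n) x)⟫_ℝ|) ∧
    (∀ n, (∫ x, ‖curl (v n) x‖ ^ 2) ≤ Θ * ∫ x, frobeniusNormSq (fderiv ℝ (curl (v n)) x))

/-- An EXACTLY EXTREMAL EXTENDED SLICE (verbatim slice clause of items 26569/27696 with `W t ↦ w`): smooth, divergence-free,
bounded gradient, `D¹w, D²w ∈ L²`, and a height bound `M` with `0 < M√Z√P` at which `κ⋆·M·√Z·√P ≤ |J(w)|`. -/
def IsExtremalSlice (w : EuclideanSpace ℝ (Fin 3) → EuclideanSpace ℝ (Fin 3)) : Prop :=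
  (ContDiff ℝ (⊤ : ℕ∞) w ∧ Literature.Analysis.FluidPDE.VectorCalculus.IsDivFree w ∧ (∃ B : ℝ, ∀ x, ‖fderiv ℝ w x‖ ≤ B) ∧ (∫⁻ x, ‖iteratedFDeriv ℝ 1 w x‖ₑ ^ 2 < ⊤) ∧ (∫⁻ x, ‖iteratedFDeriv ℝ 2 w x‖ₑ ^ 2 < ⊤) ∧ ∃ M : ℝ, (∀ x, ‖w x‖ ≤ M) ∧ 0 < M * Real.sqrt (∫ x, ‖Literature.Analysis.FluidPDE.curl w x‖ ^ 2) * Real.sqrt (∫ x, Literature.Analysis.FluidPDE.frobeniusNormSq (fderiv ℝ (Literature.Analysis.FluidPDE.curl w) x)) ∧ (sInf {κ : ℝ | (∀ (v : EuclideanSpace ℝ (Fin 3) → EuclideanSpace ℝ (Fin 3)) (M B : ℝ), ContDiff ℝ (⊤ : ℕ∞) v → Literature.Analysis.FluidPDE.VectorCalculus.IsDivFree v → (∀ x, ‖v x‖ ≤ M) → (∀ x, ‖fderiv ℝ v x‖ ≤ B) → (∫⁻ x, ‖iteratedFDeriv ℝ 0 v x‖ₑ ^ 2 < ⊤) → (∫⁻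 x, ‖iteratedFDeriv ℝ 1 v x‖ₑ ^ 2 < ⊤) → (∫⁻ x, ‖iteratedFDeriv ℝ 2 v x‖ₑ ^ 2 < ⊤) → |∫ x, ⟪Literature.Analysis.FluidPDE.curl v x, fderiv ℝ v x (Literature.Analysis.FluidPDE.curl v x)⟫_ℝ| ≤ κ * M * Real.sqrt (∫ x, ‖Literature.Analysis.FluidPDE.curl v x‖ ^ 2) * Real.sqrt (∫ x, Literature.Analysis.FluidPDE.frobeniusNormSq (fderiv ℝ (Literature.Analysis.FluidPDE.curl v) x)))}) * M * Real.sqrt (∫ x, ‖Literature.Analysis.FluidPDE.curl w x‖ ^ 2) * Real.sqrt (∫ x, Literature.Analysis.FluidPDE.frobeniusNormSq (fderiv ℝ (Literature.Analysis.FluidPDE.curl w) x)) ≤ |∫ x, ⟪Literature.Analysis.FluidPDE.curl w x, fderiv ℝ w x (Literature.Analysis.FluidPDE.curl w x)⟫_ℝ|)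

/-- A TUBE SLICE: smooth, divergence-free, bounded gradient, height bound `M`, INFINITE budget (`D¹w` or `D²w` not in `L²`), and
asymptotically `κ⋆`-efficient at height `M` along an exhaustion by bounded measurable sets `D k ⊇ B(0, ρ k)`, `ρ k → ∞`, with
deficits `δ k → 0` (plain restricted integrals — no cut-off correction).  The single-slice, exhaustion form of item 27695's sheet. -/
def IsTubeSlice (w : EuclideanSpace ℝ (Fin 3) → EuclideanSpace ℝ (Fin 3)) : Prop :=
  ContDiff ℝ (⊤ : ℕ∞) w ∧ Literature.Analysis.FluidPDE.VectorCalculus.IsDivFree w ∧ (∃ B : ℝ, ∀ x, ‖fderiv ℝ w x‖ ≤ B) ∧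
    ¬ ((∫⁻ x, ‖iteratedFDeriv ℝ 1 w x‖ₑ ^ 2 < ⊤) ∧ (∫⁻ x, ‖iteratedFDeriv ℝ 2 w x‖ₑ ^ 2 < ⊤)) ∧
    ∃ (M : ℝ) (D : ℕ → Set (EuclideanSpace ℝ (Fin 3))) (ρ δ : ℕ → ℝ), (∀ x, ‖w x‖ ≤ M) ∧
      Tendsto ρ atTop atTop ∧ Tendsto δ atTop (𝓝 0) ∧
      ∀ k, MeasurableSet (D k) ∧ Metric.ball 0 (ρ k) ⊆ D k ∧ Bornology.IsBounded (D k) ∧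
        (kStar - δ k) * M * Real.sqrt (∫ x in D k, ‖curl w x‖ ^ 2) * Real.sqrt (∫ x in D k, frobeniusNormSq (fderiv ℝ (curl w) x)) ≤
          |∫ x in D k, ⟪curl w x, fderiv ℝ w x (curl w x)⟫_ℝ|

/-- ZOOM COMPACTNESS of a family of slices: along ANY centres `y n` and ANY subsequence `φ`, a further subsequence of the translates
`v (φ (ψ n)) (y (φ (ψ n)) + ·)` converges pointwise to a slice `W s`, `s < 0`, of a Type-I ANCIENT MILD field
(`IsTypeIAncientMild K W`: smooth on `(-∞,0) × ℝ³`, divergence-free, Oseen-mild between all `s < t < 0`, `‖W t‖_∞ ≤ K/√(-t)`). -/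
def ZoomCompact (v : ℕ → EuclideanSpace ℝ (Fin 3) → EuclideanSpace ℝ (Fin 3)) : Prop :=
  ∀ (y : ℕ → EuclideanSpace ℝ (Fin 3)) (φ : ℕ → ℕ), StrictMono φ →
    ∃ (ψ : ℕ → ℕ) (K s : ℝ) (W : ℝ → EuclideanSpace ℝ (Fin 3) → EuclideanSpace ℝ (Fin 3)), StrictMono ψ ∧
      Literature.Analysis.FluidPDE.IsTypeIAncientMild K W ∧ s < 0 ∧
      ∀ z, Tendsto (fun n => v (φ (ψ n)) (y (φ (ψ n)) + z)) atTop (𝓝 (W s z))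

/-! ## §1 The four statements of the line -/

/-- (T0 — PROVED in §1c, the sequential «no dust» form of the upper scale lock) EFFICIENT TIMES WITH A TAYLOR BOUND: a violator
flow has a sequence of late times `t n → T` that are near-efficient (deficit `→ 0`) AND carry the Taylor bound `Z ≤ Θ·ν(T-t)·P`
(dissipation length at most parabolic).  Both halves at once are the landed `PerFlow.upperLock_at_nearEfficient_times` (g4-α:
`lockedTimes_logDensity` + `efficientTimes_logDensity_of_not_perFlow`); the opposite half `Z/P ≳ ν(T-t)` at near-efficient times is
the landed `PerFlow.lowerLock_at_nearEfficient_times` (not needed here). -/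
def EfficientTimesNoDust : Prop :=
  ∀ (C ν T : ℝ) (u : ℝ → EuclideanSpace ℝ (Fin 3) → EuclideanSpace ℝ (Fin 3)) (p : ℝ → EuclideanSpace ℝ (Fin 3) → ℝ),
    IsViolator C ν T u p → ∃ (Θ : ℝ) (t Mb ε : ℕ → ℝ), EfficientTimesData ν T u Θ t Mb ε

/-- (T1 — the NEW LEVER, slice-level pure analysis) COHERENT SELECTION: a near-extremal height-`1` family with a Taylor bound has
centres, a subsequence and a pointwise limit of translates which is an exactly extremal extended slice (finite budget) or a tube
slice (infinite budget).  Mechanism: cell-wise Cauchy–Schwarz at global height; share of a cell of Taylor scale `L` is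
`≤ √(Z/P)/L ≤ √Θ/L`; nested selection; `C^∞_loc` compactness from the uniform bounds; `extendedSharp` closes the finite case. -/
def CoherentSelection : Prop :=
  ∀ (v : ℕ → EuclideanSpace ℝ (Fin 3) → EuclideanSpace ℝ (Fin 3)) (Λ : ℕ → ℝ) (Θ : ℝ) (ε : ℕ → ℝ),
    NearExtremalFamily v Λ Θ ε →
      ∃ (y : ℕ → EuclideanSpace ℝ (Fin 3)) (φ : ℕ → ℕ) (W₀ : EuclideanSpace ℝ (Fin 3) → EuclideanSpace ℝ (Fin 3)),
        StrictMono φ ∧ (∀ z, Tendsto (fun n => v (φ n) (y (φ n) + z)) atTop (𝓝 (W₀ z))) ∧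
        (IsExtremalSlice W₀ ∨ IsTubeSlice W₀)

/-- (T2 — glue on landed KNSS compactness, parabolic regularity and Type-I inheritance) ZOOM PACKAGE: for a violator flow with
efficient-times data, the NS-COMPATIBLE zoomed slices `v n y := (Mb n)⁻¹ • u (t n) ((ν / Mb n) • y)` (height `1`, length `ν/Mb n`,
so that `(s,y) ↦ (Mb n)⁻¹ u(t n + (ν/(Mb n)²) s, (ν/Mb n) y)` is a unit-viscosity solution with `v n` as its time-`0` slice and blow-up
at `s = (Mb n)² (T - t n)/ν ∈ [c₀², C²(1+o(1))]`) form, along a subsequence `σ` (late times: the zoomed solution exists on `s ∈ [-1,0]` and `(Mb n)²(T-t n)/ν` converges), a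
near-extremal family (efficiency is invariant under the zoom; `Z ≤ Θ' P` with `Θ' = Θ·sup (Mb n)²(T-t n)/ν`) and are zoom-compact (KNSS 2009 Prop. 4.1 / Lemma 6.1, landed as
`Literature.Analysis.FluidPDE.KNSS2009_lemma61_ancientMild_of_oseenMild`, `isKNSSBlowupLimit_of_oseenMild_zoom_nearVertex`; Leray's
lower rate `lerayLowerRate_of_not_extends` keeps the vertex at `s* < 0`). -/
def ZoomPackage : Prop :=
  ∀ (C ν T : ℝ) (u : ℝ → EuclideanSpace ℝ (Fin 3) → EuclideanSpace ℝ (Fin 3)) (p : ℝ → EuclideanSpace ℝ (Fin 3) → ℝ),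
    IsViolator C ν T u p → ∀ (Θ : ℝ) (t Mb ε : ℕ → ℝ), EfficientTimesData ν T u Θ t Mb ε →
      ∃ (σ : ℕ → ℕ) (Λ : ℕ → ℝ) (Θ' : ℝ) (ε' : ℕ → ℝ), StrictMono σ ∧
        NearExtremalFamily (fun n y => (Mb (σ n))⁻¹ • u (t (σ n)) ((ν / Mb (σ n)) • y)) Λ Θ' ε' ∧
        ZoomCompact (fun n y => (Mb (σ n))⁻¹ • u (t (σ n)) ((ν / Mb (σ n)) • y))

/-- (T3 — OPEN HEART #2) NO TUBE SLICE: no slice of a Type-I ancient mild field is a tube slice (infinite budget, asymptotically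
`κ⋆`-efficient along an exhaustion).  The single-slice form of item 27695 `NoQuantumSheet`; implied by the KNSS Type-I Liouville
conjecture (`W ≡ 0`); constants, 2D and axisymmetric-no-swirl Type-I ancient fields are excluded by KNSS 2009 Thms 1.1–1.3. -/
def NoTubeSlice : Prop :=
  ∀ (K : ℝ) (W : ℝ → EuclideanSpace ℝ (Fin 3) → EuclideanSpace ℝ (Fin 3)) (s : ℝ),
    Literature.Analysis.FluidPDE.IsTypeIAncientMild K W → s < 0 → ¬ IsTubeSlice (W s)

/-! ## §1b First lemma of the new lever: the share bound -/

/-- **First lemma of T1, PROVED** — the SHARE BOUND (pure algebra): cores of Taylor scale ≥ L₁ (`L₁² P_i ≤ Z_i`) have total CS-weight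
`Σ √(Z_i P_i) ≤ (√Θ / L₁) · √(Z P)` under the Taylor bound `Z ≤ Θ P`, where `Σ Z_i ≤ Z`. -/
theorem share_le_of_taylor {ι : Type*} (s : Finset ι) (Zc Pc : ι → ℝ) (Z P Θ L₁ : ℝ)
    (hL₁ : 0 < L₁) (hPc : ∀ i ∈ s, 0 ≤ Pc i) (hlow : ∀ i ∈ s, L₁ ^ 2 * Pc i ≤ Zc i)
    (hsum : ∑ i ∈ s, Zc i ≤ Z) (hP : 0 ≤ P) (hT : Z ≤ Θ * P) :
    ∑ i ∈ s, Real.sqrt (Zc i * Pc i) ≤ Real.sqrt Θ / L₁ * Real.sqrt (Z * P) := by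
  have hZc : ∀ i ∈ s, 0 ≤ Zc i := fun i hi => le_trans (mul_nonneg (sq_nonneg L₁) (hPc i hi)) (hlow i hi)
  -- each term: √(Zc·Pc) ≤ Zc / L₁
  have hterm : ∀ i ∈ s, Real.sqrt (Zc i * Pc i) ≤ Zc i / L₁ := by
    intro i hi
    have h1 : Zc i * Pc i ≤ (Zc i / L₁) ^ 2 := by
      rw [div_pow]
      rw [le_div_iff₀ (by positivity)]
      have := hlow i hi
      nlinarith [hZc i hi, hPc i hi]
    calc Real.sqrt (Zc i * Pc i) ≤ Real.sqrt ((Zc i / L₁) ^ 2) := Real.sqrt_le_sqrt h1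
      _ = Zc i / L₁ := Real.sqrt_sq (div_nonneg (hZc i hi) hL₁.le)
  have hZ0 : 0 ≤ Z := le_trans (Finset.sum_nonneg hZc) hsum
  have hΘP : Z * Z ≤ Θ * (Z * P) := by nlinarith
  calc ∑ i ∈ s, Real.sqrt (Zc i * Pc i) ≤ ∑ i ∈ s, Zc i / L₁ := Finset.sum_le_sum hterm
    _ = (∑ i ∈ s, Zc i) / L₁ := by rw [Finset.sum_div]
    _ ≤ Z / L₁ := by gcongr
    _ = Real.sqrt (Z * Z) / L₁ := by rw [Real.sqrt_mul_self hZ0]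
    _ ≤ Real.sqrt (Θ * (Z * P)) / L₁ := by gcongr
    _ = Real.sqrt Θ / L₁ * Real.sqrt (Z * P) := by
        have hΘ : 0 ≤ Θ ∨ Θ < 0 := le_or_gt 0 Θ
        rcases hΘ with hΘ | hΘ
        · rw [Real.sqrt_mul hΘ]; ring
        · -- Θ < 0 forces Z * P ≤ 0 … handle: Z ≤ Θ P with P ≥ 0, Θ < 0 ⇒ Z ≤ 0 ⇒ Z = 0
          have hZle : Z ≤ 0 := le_trans hT (mul_nonpos_of_nonpos_of_nonneg hΘ.le hP) |>.trans (le_refl 0)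
          have hZ : Z = 0 := le_antisymm hZle hZ0
          simp [hZ]

/-! ## §1c T0 is a THEOREM: efficient late times WITH the Taylor bound (landed `PerFlow.upperLock_at_nearEfficient_times`) -/

/-- **T0 PROVED.**  A violator flow has efficient-times data with a Taylor bound: for every `n`, the landed
`DepletionLadder.PerFlow.upperLock_at_nearEfficient_times` (g4-α: locked times have positive lower log-density, efficient times have
full upper log-density) gives, past the onset `T - T/(n+1)`, a time at which the flow is strictly `κ⋆(1 - 1/(n+2))`-efficient at some
height bound `M` AND `Z ≤ c₂·ν(T-t)·P`; positivity of `M` and of the budgets follows from the flow-wise sharp inequality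
(`flowwise_of_universal sharpDepletion_is_universal`). -/
theorem efficientTimesNoDust_holds : EfficientTimesNoDust := by
  intro C ν T u p hV
  obtain ⟨hC, hν, hT, hsol, hLH, hdec, hrate, hext, hnot⟩ := hV
  obtain ⟨c₂, hc₂⟩ := DepletionLadder.PerFlow.upperLock_at_nearEfficient_times hC hν hT hsol hLH hdec hrate hext hnot
  have hK : 0 < kStar := kStar_pos
  have hfw := DepletionLadder.flowwise_of_universal DepletionLadder.sharpDepletion_is_universal hν hT hsol hLH hdec
  -- one efficient, Taylor-bounded time past each onset `T - T/(n+1)`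
  have key : ∀ n : ℕ, ∃ t : ℝ, t ∈ Set.Ico (T - T / ((n : ℝ) + 1)) T ∧ t ∈ Set.Ico 0 T ∧ ∃ M : ℝ, (∀ x, ‖u t x‖ ≤ M) ∧
      (kStar - kStar / ((n : ℝ) + 2)) * M * Real.sqrt (∫ x, ‖curl (u t) x‖ ^ 2) *
          Real.sqrt (∫ x, frobeniusNormSq (fderiv ℝ (curl (u t)) x)) <
        |∫ x, ⟪curl (u t) x, fderiv ℝ (u t) x (curl (u t) x)⟫_ℝ| ∧
      (∫ x, ‖curl (u t) x‖ ^ 2) ≤ c₂ * (ν * (T - t)) * ∫ x, frobeniusNormSq (fderiv ℝ (curl (u t)) x) := by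
    intro n
    have hn1 : (0 : ℝ) < (n : ℝ) + 1 := by positivity
    have hn2 : (0 : ℝ) < (n : ℝ) + 2 := by positivity
    have hm : 0 < kStar - kStar / ((n : ℝ) + 2) := by
      rw [sub_pos, div_lt_iff₀ hn2]; nlinarith
    have hmlt : kStar - kStar / ((n : ℝ) + 2) < kStar := by
      have : 0 < kStar / ((n : ℝ) + 2) := div_pos hK hn2
      linarith
    have ht₁ : T - T / ((n : ℝ) + 1) ∈ Set.Ico 0 T := by
      refine ⟨?_, ?_⟩
      · rw [sub_nonneg, div_le_iff₀ hn1]; nlinarith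
      · have : 0 < T / ((n : ℝ) + 1) := div_pos hT hn1
        linarith
    have hmlt' := hmlt
    unfold kStar udcSet at hmlt'
    have hne := hc₂ _ hm hmlt' _ ht₁
    obtain ⟨t, ht⟩ := MeasureTheory.nonempty_of_measure_ne_zero hne
    simp only [Set.mem_setOf_eq] at ht
    obtain ⟨htI, ⟨M, hM, hstrict⟩, hZ⟩ := ht
    refine ⟨t, htI, ⟨le_trans ht₁.1 htI.1, htI.2⟩, M, hM, ?_, hZ⟩
    have := hstrict
    unfold kStar udcSet
    exact this
  choose t htI ht0 M hM hstrict hZ using key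
  refine ⟨c₂, t, M, fun n => kStar / ((n : ℝ) + 2), ht0, ?_, ?_, ?_, hM, ?_, ?_, ?_⟩
  · -- `t n → T`: squeezed between `T - T/(n+1)` and `T`
    have hlow : Tendsto (fun n : ℕ => T - T / ((n : ℝ) + 1)) atTop (𝓝 T) := by
      have h1 : Tendsto (fun n : ℕ => T / ((n : ℝ) + 1)) atTop (𝓝 0) :=
        tendsto_const_nhds.div_atTop (tendsto_natCast_atTop_atTop.atTop_add tendsto_const_nhds)
      simpa using tendsto_const_nhds.sub h1
    exact tendsto_of_tendsto_of_tendsto_of_le_of_le hlow tendsto_const_nhds (fun n => (htI n).1) (fun n => (htI n).2.le)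
  · -- `ε n = κ⋆/(n+2) → 0`
    exact tendsto_const_nhds.div_atTop (tendsto_natCast_atTop_atTop.atTop_add tendsto_const_nhds)
  · -- `0 < M n`: else the flow-wise sharp inequality contradicts strict efficiency
    intro n
    have hJle := hfw (t n) (ht0 n) (M n) (hM n)
    have hM0 : 0 ≤ M n := le_trans (norm_nonneg _) (hM n 0)
    by_contra hneg
    have hMz : M n = 0 := le_antisymm (not_lt.1 hneg) hM0
    have h1 := hstrict n
    rw [hMz] at h1 hJle
    simp only [mul_zero, zero_mul] at h1 hJle
    linarith
  · -- `0 < √Z·√P`: same argument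
    intro n
    have hJle := hfw (t n) (ht0 n) (M n) (hM n)
    have h1 := hstrict n
    have hnn : 0 ≤ Real.sqrt (∫ x, ‖curl (u (t n)) x‖ ^ 2) * Real.sqrt (∫ x, frobeniusNormSq (fderiv ℝ (curl (u (t n))) x)) :=
      mul_nonneg (Real.sqrt_nonneg _) (Real.sqrt_nonneg _)
    by_contra hneg
    have hz : Real.sqrt (∫ x, ‖curl (u (t n)) x‖ ^ 2) * Real.sqrt (∫ x, frobeniusNormSq (fderiv ℝ (curl (u (t n))) x)) = 0 :=
      le_antisymm (not_lt.1 hneg) hnn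
    have e1 : (kStar - kStar / ((n : ℝ) + 2)) * M n * Real.sqrt (∫ x, ‖curl (u (t n)) x‖ ^ 2) *
        Real.sqrt (∫ x, frobeniusNormSq (fderiv ℝ (curl (u (t n))) x)) = 0 := by
      rw [mul_assoc, hz, mul_zero]
    have e2 : sInf udcSet * M n * Real.sqrt (∫ x, ‖curl (u (t n)) x‖ ^ 2) *
        Real.sqrt (∫ x, frobeniusNormSq (fderiv ℝ (curl (u (t n))) x)) = 0 := by
      rw [mul_assoc, hz, mul_zero]
    unfold udcSet at e2
    linarith
  · exact fun n => (hstrict n).le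
  · exact hZ

/-! ## §2 The extremal branch is closed UNCONDITIONALLY (landed `extendedSharp` + interior contact + `plateauSliceRigidity`) -/

/-- **No slice of a Type-I ancient mild field is an exactly extremal extended slice.**  Equality in the extended sharp inequality
(`ExtremiserLiouville.extendedSharp`) forces a plateau `{‖W s‖ = M}` with non-empty interior
(`ext_interior_contact_nonempty_of_extremal`), hence of positive volume; the Type-I ancient mild structure (continuity on
`(-∞,0) × ℝ³`, Oseen-mild identity, rate `√(-t)‖W t‖ ≤ K`) then contradicts the landed one-slice plateau rigidity
`plateauSliceRigidity` (item 27823).  [folklore] -/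
theorem not_isExtremalSlice_of_typeIAncientMild {K : ℝ} {W : ℝ → EuclideanSpace ℝ (Fin 3) → EuclideanSpace ℝ (Fin 3)} {s : ℝ}
    (hW : Literature.Analysis.FluidPDE.IsTypeIAncientMild K W) (hs : s < 0) : ¬ IsExtremalSlice (W s) := by
  intro hext
  obtain ⟨hcd, hdiv, ⟨B, hB⟩, h1, h2, M, hM, hpos, hge⟩ := hext
  have hle := extendedSharp (W s) M B hcd hdiv hM hB h1 h2
  have hatt := le_antisymm hle hge
  have hint := ext_interior_contact_nonempty_of_extremal hcd hdiv hM hB h1 h2 hpos hatt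
  have hvol : 0 < volume {x | ‖W s x‖ = M} :=
    lt_of_lt_of_le (isOpen_interior.measure_pos volume hint) (measure_mono interior_subset)
  have hMpos : 0 < M := by
    by_contra hM0
    push Not at hM0
    have hzp : 0 ≤ Real.sqrt (∫ x, ‖curl (W s) x‖ ^ 2) * Real.sqrt (∫ x, frobeniusNormSq (fderiv ℝ (curl (W s)) x)) :=
      mul_nonneg (Real.sqrt_nonneg _) (Real.sqrt_nonneg _)
    have := mul_le_mul_of_nonneg_right hM0 hzp
    rw [mul_assoc] at hpos
    linarith
  have hcont : ContinuousOn (Function.uncurry W) (Set.Iio (0 : ℝ) ×ˢ Set.univ) := hW.continuousOn_uncurry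
  have hmild : ∀ s t : ℝ, s < t → t < 0 → ∀ x, W t x = Literature.Analysis.FluidPDE.heatFlow (W s) (t - s) x -
      Literature.Analysis.FluidPDE.oseenDuhamel 1 s W W t x := hW.2.2.1
  have hdec' : ∀ t : ℝ, t < 0 → ∀ x, Real.sqrt (-t) * ‖W t x‖ ≤ K := by
    intro t ht x
    have hsq : 0 < Real.sqrt (-t) := Real.sqrt_pos.2 (by linarith)
    have h := hW.norm_le ht x
    calc Real.sqrt (-t) * ‖W t x‖ ≤ Real.sqrt (-t) * (K / Real.sqrt (-t)) := by gcongr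
      _ = K := by field_simp
  exact plateauSliceRigidity ⟨W, K, s, M, hcont, hmild, hdec', hs, hMpos, hM, hvol⟩

/-! ## §3 The reduction: T1 → T2 → T3 → the crux BY NAME (T0 is the theorem of §1c, the extremal branch is §2) -/

/-- **The rung `NearExtremalTransiencePerFlow` (26567) from the three open pieces of LINE g7-δ, by name.**  Violator frame by
contradiction → T0 data (theorem) → T2 zoom family + compactness → T1 selection → identification of the limit with a slice `W s` of a
Type-I ancient mild field → extremal branch closed by `not_isExtremalSlice_of_typeIAncientMild`, tube branch = T3. [folklore] -/
theorem nearExtremalTransiencePerFlow_of_selection (hT1 : CoherentSelection) (hT2 : ZoomPackage) (hT3 : NoTubeSlice) :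
    NearExtremalTransiencePerFlow := by
  have hT0 : EfficientTimesNoDust := efficientTimesNoDust_holds
  intro C ν T hC hν hT u p hsol hLH hdec hrate hsing
  by_contra hno
  have hV : IsViolator C ν T u p := ⟨hC, hν, hT, hsol, hLH, hdec, hrate, hsing, hno⟩
  -- T0: near-efficient late times with a Taylor bound
  obtain ⟨Θ, t, Mb, ε, hdata⟩ := hT0 C ν T u p hV
  -- T2: the NS-compatible zoomed slices form a near-extremal family and are zoom-compact
  obtain ⟨σ, Λ, Θ', ε', hσ, hfam, hcomp⟩ := hT2 C ν T u p hV Θ t Mb ε hdata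
  -- T1: coherent selection of a member; its limit is extremal or a tube
  obtain ⟨y, φ, W₀, hφ, hconv, hdich⟩ := hT1 _ Λ Θ' ε' hfam
  -- T2 (compactness at the selected centres): the limit is a slice `W s` of a Type-I ancient mild field
  obtain ⟨ψ, K, s, W, hψ, hW, hs, hconv'⟩ := hcomp y φ hφ
  have hWs : W s = W₀ :=
    funext fun z => tendsto_nhds_unique (hconv' z) ((hconv z).comp hψ.tendsto_atTop)
  subst hWs
  rcases hdich with hext | htube
  · -- extremal branch: equality in the extended sharp inequality ⇒ plateau of positive volume ⇒ `plateauSliceRigidity`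
    exact not_isExtremalSlice_of_typeIAncientMild hW hs hext
  · -- tube branch: the single-slice tube exclusion T3
    exact hT3 K W s hW hs htube

/-! ## §3b Placement of T3 (kernel-checked): the canonical Liouville conjecture (L) implies `NoTubeSlice` -/

/-- `NoTubeSlice` follows from the canonical KNSS Liouville conjecture
`Summit.NavierStokesRegularity.NavierStokesRegularity.LiouvilleConjectureNS` (bounded ancient mild ⇒ slices a.e. constant): shift
time by `δ = -s/2` (`IsTypeIAncientMild.isBoundedAncientMildSolution_sub`), read off that `W s` is a.e. constant, hence constant
(continuity), hence has zero — finite — `Ḣ¹, Ḣ²` budgets, contradicting the infinite-budget clause of `IsTubeSlice`.  So T3 sits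
BELOW (L) and ABOVE item 27695 (single slice instead of a positive-measure set of slices). -/
theorem noTubeSlice_of_liouvilleConjectureNS
    (hL : Summit.NavierStokesRegularity.NavierStokesRegularity.LiouvilleConjectureNS) : NoTubeSlice := by
  intro K W s hW hs htube
  have hδ : 0 < -s / 2 := by linarith
  have hB := hW.isBoundedAncientMildSolution_sub hδ
  have hmeas : ∀ t < 0, AEStronglyMeasurable ((fun t => W (t - -s / 2)) t) volume :=
    fun t ht => hW.aestronglyMeasurable_slice (by linarith)
  obtain ⟨b, hb⟩ := hL _ hB hmeas (s / 2) (by linarith)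
  have e : s / 2 - -s / 2 = s := by ring
  have hb' : W s =ᵐ[volume] fun _ => b := by simpa only [e] using hb
  have hWb : W s = fun _ => b :=
    (Continuous.ae_eq_iff_eq volume (hW.continuous_slice hs) continuous_const).1 hb'
  apply htube.2.2.2.1
  rw [hWb]
  refine ⟨?_, ?_⟩ <;> simp [iteratedFDeriv_const_of_ne]

end Summit.NavierStokesRegularity.NavierStokesRegularity.Theorems.DepletionLadder.PerFlow.MemberSelection

end
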